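import Literature.MathematicalPhysics.QuantumFieldTheory.Balaban1983to89.B9Thm311SmallFieldCoercivityTowerDiagonal
import Literature.MathematicalPhysics.QuantumFieldTheory.Balaban1983to89.B9Eq325RLipschitzSqrtTowerLinear

/-!
# `Balaban1983to89.B9Thm311SmallFieldCoercivityTowerClosed` — T. Bałaban, *Propagators for lattice gauge theories in a background field*, Commun. Math.
# Phys. **99** (1985) 389–434 [Balaban1985BackgroundPropagators] Thm 3.11 p. 416 with (3.15)–(3.16) p. 393, (3.25) p. 394, (3.35) p. 396, (3.82)–(3.86) p. 407;
# [Balaban1984PropagatorsI] Prop. 1.1 (1.90) p. 33: **THE `k`-LEVEL STRONG SMALL-FIELD COERCIVITY OF THE PRINCIPAL GAUGE-FIXED OPERATOR ON PRINT's DIAGONAL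
# WITH NO DISPLAYED OPERATOR LETTER** — `B9Thm311SmallFieldCoercivityTowerDiagonal.strong_coercive_tower_diagonal` (the owner's (SC-k) modulo the `k`-level
# `R`-letter `C_R` alone) with its one slot `hR` INHABITED by NE9 leaf-04's α-linear `k`-level `R`-letter
# `B9Eq325RLipschitzSqrtTowerLinear.norm_RofUk_sub_RofUk_one_le_diagonal_linear` (print's (3.25) route one storey up: the owner's `B9Eq324DeltaPrimeATower` ∕
# `B9Eq325ProjFormulaTower` ∕ `B9Thm311FlatLettersTower`, leaf-01's `κ^{−1∕2}` road and sharp floor, leaf-02's `ℓ²` tower letters, leaf-04's Green step), and the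
# `∃ α₀ γ′` PACKAGED BEFORE every lattice ∕ height ∕ volume ∕ background binder

statement-level skeleton of published theorems with citation tags; proofs where landed; nothing here is a claim about the Yang–Mills mass gap

CITATION HEADER (lean-in-tree rule).  Audit cell `pub-balaban`, sub-cell `t4`, BINDER row NE9; filed by the row OWNER lineage `b2b-balaban-t4-ne9-p1`
(gen 85), INTENT I-ne9p1-g85-8 (NE9 leaf-04 g75 W-3: «the ∃-packaging … YOURS»; their junction probe `Probe_Junction_OwnerI4` certified the one-term
composition).  Sources READ by this lineage in the held text `paper:balaban1985-cmp99-background-propagators` (journal page = PDF page + 388): pp. 393–396,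
403, 407, 416.

THE PRINT (verbatim).  p. 416, Thm 3.11: *«Under the assumptions of the Theorems 3.1–3.10 (i.e. for M sufficiently large and α₀ sufficiently small) the
operators Δ′_a, G′, (Q′G′²Q′*)⁻¹, Δ_a, G are positive definite.»*; p. 393: the `k`-th step lives on the `η = L^{−k}` lattice with the weights (3.16);
p. 396, (3.35): the scaled small-field window; p. 403: *«R(U), P(U) = I − R(U) … satisfy the same bounds»*.

WHAT IS PROVED (sorry-free; no `def`, no `Prop` placeholder; no inequality of the paper asserted).
* §1 `theta_mono` (the threshold polynomial `Θ` of `…TowerScaled` is monotone in the `R`-letter), `hLb_of_hU1` (E162's per-level `U1` datum read on bonds).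
* §2 **`exists_strong_coercive_tower_diagonal_closed`** — for the block size `L`, the fibre letters `M_φ, M_φ′` and `a > 0`, a profile ratio `0 ≤ r < 1`,
  THERE ARE `α₀, γ′ > 0` — CLOSED FORMS in `(d, a, L, M_φ, M_φ′, r)` (`γ′ = γ(d,a)∕2`; `α₀` = the minimum of six explicit thresholds: the level-profile
  window `d(L−1)·2M_φM_φ′α∕(1−r) ≤ 1`, `θ̄ ≤ 1`, `s_Dα ≤ 1`, `γ_m ≥ 1∕8` (at the auxiliary site penalty `a′ = 1`), leaf-04's `2s_Aα ≤ s♯` through the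
  bound `s_A ≤ S̄ = 2(48s_D + 192s_Q) + 4s_Q`, and the three thresholds of `…TowerDiagonal` at `C_R := 3S̄∕s♯`) — such that for EVERY number of levels
  `n`, spacing `η` with `ηL^{n+1} = 1`, weights `c₀(L^{n+1})^d = c₁`, volume `m`, background `U` with E162's per-level averaging data, mutually adjoint
  transporters, unit-bounded `αη`-small bond variables and level averages `‖Ū^j(b) − 1‖ ≤ ε_j ≤ αr^j`, and `0 ≤ α ≤ α₀`:
  `γ′·(‖D(1)x‖² + ‖D*(1)x‖² + ‖x‖²) ≤ re⟨x, (D*D + D R_k(U) D* + a Q_k(U)†Q_k(U)) x⟩`.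
  NO operator letter displayed: `K_R`, `M_Q`, `C_Q` (leaf-02) and `C_R` (ROUTE G) are theorems of the tree; what stays displayed is the small-field WINDOW
  (print's running axioms (3.35) ∕ [I] (1.11)–(1.14)), E162's data and `hRS`.
MODEL ∕ DECLARED READINGS.  As `…TowerDiagonal` (M1)–(M4) with (M3) discharged; the auxiliary site penalty of the (3.25) representation is fixed at `a′ = 1`
(`R_k(U)` does not depend on it); constants crude (leaf-04's `s♯`, `s_A`; this file's `S̄` cruder still), `L`-dependent as print's, free of `n`, `η`, `m`,
`c₀`, `c₁`.  NOT HERE: the derivation of the windows from plaquette smallness (gauge step, [B9] Lemma 3.1 ∕ (3.37)), decay, infinite volume.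
HONEST SCOPE.  [folklore] ∃-packaging of two landed∕staged letters by threshold arithmetic; «NE9 ⇐ the named binders»; NE9 NOT PRINTED ∕ NOT PROVED; NOT
summit progress (cell pub-balaban: row NE9 WALLED ON A MODEL; spine PROVED 0/9; rung (B)+1 finite T⁴ — NOT infinite volume, NOT mass gap, NOT Clay; HONEST
DEPENDENCY: continuum YM on T⁴ ⇐ BetaPertH ∧ nine spine estimates (0/9 proved); BetaPertH ⇐ (D1) ∧ (D4) ∧ CAP+tail; G-an2-4 gates asym, D1 and
NE2/3/4).  NEW file importing `B9Thm311SmallFieldCoercivityTowerDiagonal` and `B9Eq325RLipschitzSqrtTowerLinear`; modifies nothing.  Net new unproved facts: 0.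
-/

noncomputable section

open scoped InnerProductSpace ComplexConjugate BigOperators

namespace Literature.MathematicalPhysics.QuantumFieldTheory.Balaban1983to89.B9Thm311SmallFieldCoercivityTowerClosed

open B4Sect5Torus (TSite)
open B9SectCLatticeCarrier (Bond)
open B9Eq319QprimeTorus (fineP)
open B11Eq103H1Complex (SiteL2K BondL2K covDivL2K laplaceALatticeK)
open B9Eq310HessianOperator (adTransportW principalOpK covCurlL2K)
open B9Eq315QTorus (perCfg cornerSite)
open B9Eq315QTorusOnto (liftSite perSite_liftSite)
open B9Eq315QTower (towerP UlevOf)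
open B9Eq326OperatorTower (QkW RofUk)
open B7Prop1Explicit (U1 Wcx boxVec)
open B9Thm311SmallFieldCoercivityTowerDiagonal (strong_coercive_tower_diagonal)
open B9Eq325RLipschitzSqrtTowerLinear (norm_RofUk_sub_RofUk_one_le_diagonal_linear)

/-! ## §1 Two small letters -/

/-- The threshold polynomial `Θ(C_R)` of `B9Thm311SmallFieldCoercivityTowerScaled` is monotone in the `R`-letter `C_R ≥ 0`. [folklore] -/
private theorem theta_mono {d : ℕ} {a KR CQ MQ CR CR' : ℝ} (hKR : 0 ≤ KR) (hCR : 0 ≤ CR) (hle : CR ≤ CR') :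
    5 * Real.sqrt d * KR + 17 * d * KR ^ 2 + Real.sqrt d * KR * CR + 2 * CR + CR ^ 2 + a * CQ * (2 * MQ + CQ) ≤
      5 * Real.sqrt d * KR + 17 * d * KR ^ 2 + Real.sqrt d * KR * CR' + 2 * CR' + CR' ^ 2 + a * CQ * (2 * MQ + CQ) := by
  have hd : (0 : ℝ) ≤ Real.sqrt d := Real.sqrt_nonneg _
  have h1 : Real.sqrt d * KR * CR ≤ Real.sqrt d * KR * CR' := mul_le_mul_of_nonneg_left hle (mul_nonneg hd hKR)
  have h2 : CR ^ 2 ≤ CR' ^ 2 := pow_le_pow_left₀ hCR hle 2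
  linarith

/-- The auxiliary site coercivity at the threshold stays above `1∕8` (at `a′ = 1`: `γ_f = 1∕4`) when `s_Dα₀ ≤ 1`, `s_Qα₀ ≤ 1` and
`2s_Dα₀ + 3s_Qα₀ ≤ 1∕8`. [folklore] -/
private theorem gamma_m_ge {sD sQ α₀ θb γm : ℝ} (hsD : 0 ≤ sD) (hsQ : 0 ≤ sQ) (hα : 0 ≤ α₀)
    (h3 : 2 * (sD * α₀) + 3 * (sQ * α₀) ≤ 1 / 8) (hθb : θb = sQ * α₀)
    (hγm : γm = 1 / (2 + 2 / (1 : ℝ)) - (sD * α₀ + (sD * α₀) ^ 2 + (1 : ℝ) * θb * (2 * 1 + θb))) : 1 / 8 ≤ γm := by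
  have pD : 0 ≤ sD * α₀ := mul_nonneg hsD hα
  have pQ : 0 ≤ sQ * α₀ := mul_nonneg hsQ hα
  have h1 : sD * α₀ ≤ 1 := by linarith
  have e1 : (sD * α₀) ^ 2 ≤ sD * α₀ := by
    rw [sq]; exact (mul_le_mul_of_nonneg_left h1 pD).trans (by rw [mul_one])
  have e2 : (1 : ℝ) * θb * (2 * 1 + θb) ≤ 3 * (sQ * α₀) := by
    rw [one_mul, hθb]
    have : 2 * 1 + sQ * α₀ ≤ 3 := by linarith
    calc sQ * α₀ * (2 * 1 + sQ * α₀) ≤ sQ * α₀ * 3 := mul_le_mul_of_nonneg_left this pQ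
      _ = 3 * (sQ * α₀) := by ring
  have hq : (1 : ℝ) / (2 + 2 / 1) = 1 / 4 := by norm_num
  rw [hγm, hq]
  linarith

/-- The slope letter `s_A` at the threshold is below `S̄ = 2(48s_D + 192s_Q) + 4s_Q` once `γ_m ≥ 1∕8` and `θ̄ ≤ 1`. [folklore] -/
private theorem sA_le_bar {sD sQ θb γm sG sA : ℝ} (hsD : 0 ≤ sD) (hsQ : 0 ≤ sQ) (hθb0 : 0 ≤ θb) (hθb1 : θb ≤ 1) (hγm : 1 / 8 ≤ γm)
    (hsG : sG = 2 * sD * (γm⁻¹ * (Real.sqrt γm)⁻¹) + (|(1 : ℝ)| * sQ * ((1 + θb) + 1)) * γm⁻¹ ^ 2)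
    (hsA : sA = sG * (1 + θb) + (2 + 2 / (1 : ℝ)) * sQ) : sA ≤ 2 * (48 * sD + 192 * sQ) + 4 * sQ := by
  have hγm0 : 0 < γm := lt_of_lt_of_le (by norm_num) hγm
  have hγinv : γm⁻¹ ≤ 8 := by rw [inv_le_comm₀ hγm0 (by norm_num)]; linarith
  have hγsqrt : (Real.sqrt γm)⁻¹ ≤ 3 := by
    have hs : Real.sqrt (1 / 8) ≤ Real.sqrt γm := Real.sqrt_le_sqrt hγm
    have h18 : (1 : ℝ) / 3 ≤ Real.sqrt (1 / 8) := by
      rw [show (1 : ℝ) / 3 = Real.sqrt ((1 / 3) ^ 2) by rw [Real.sqrt_sq (by norm_num)]]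
      exact Real.sqrt_le_sqrt (by norm_num)
    have hpos : 0 < Real.sqrt γm := Real.sqrt_pos.2 hγm0
    rw [inv_le_comm₀ hpos (by norm_num)]
    linarith
  have hγinv0 : 0 ≤ γm⁻¹ := by positivity
  have hγsqrt0 : 0 ≤ (Real.sqrt γm)⁻¹ := by positivity
  have hsGle : sG ≤ 48 * sD + 192 * sQ := by
    rw [hsG, abs_one, one_mul]
    have h1 : γm⁻¹ * (Real.sqrt γm)⁻¹ ≤ 8 * 3 := mul_le_mul hγinv hγsqrt hγsqrt0 (by norm_num)
    have h2 : γm⁻¹ ^ 2 ≤ 8 ^ 2 := pow_le_pow_left₀ hγinv0 hγinv 2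
    have h3 : (1 + θb) + 1 ≤ 3 := by linarith
    have h4 : 2 * sD * (γm⁻¹ * (Real.sqrt γm)⁻¹) ≤ 2 * sD * (8 * 3) := mul_le_mul_of_nonneg_left h1 (by positivity)
    have h5 : sQ * ((1 + θb) + 1) * γm⁻¹ ^ 2 ≤ sQ * 3 * 8 ^ 2 :=
      mul_le_mul (mul_le_mul_of_nonneg_left h3 hsQ) h2 (by positivity) (by positivity)
    linarith
  have hsG0 : 0 ≤ sG := by rw [hsG]; positivity
  have h1 : sG * (1 + θb) ≤ (48 * sD + 192 * sQ) * 2 := mul_le_mul hsGle (by linarith) (by positivity) (by positivity)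
  have hq : (2 : ℝ) + 2 / 1 = 4 := by norm_num
  rw [hsA, hq]
  linarith

/-- E162's per-level datum `perCfg (UlevOf U j) x κ ∈ U1` read on the bonds of the level torus: `Ū^j(b) ∈ U1`. [cite: Balaban1985Averaging, (1) p.17, Prop. 2 (52) p.26] -/
theorem hLb_of_hU1 {d : ℕ} (L : ℕ) [NeZero L] (m : Fin d → ℕ) [∀ i, NeZero (m i)] (n : ℕ) {𝔸 : Type*} [NormedRing 𝔸] [NormedAlgebra ℂ 𝔸]
    [CompleteSpace 𝔸] [NormOneClass 𝔸] (U : Bond d (towerP L m (n + 1)) → 𝔸ˣ)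
    (hU1 : ∀ (j : ℕ) (x : B7Prop1Explicit.Site d) (κ : Fin d), perCfg (towerP L m (j + 1)) (UlevOf L m (n + 1) U j) x κ ∈ U1 𝔸)
    (j : ℕ) (b : Bond d (towerP L m (j + 1))) : UlevOf L m (n + 1) U j b ∈ U1 𝔸 := by
  have h := hU1 j (liftSite b.1) b.2
  rw [B9Eq315QTorus.perCfg_apply, perSite_liftSite] at h
  exact h

/-! ## §2 (SC-k) on print's diagonal with no displayed operator letter -/

section Exists

variable {d : ℕ} (L : ℕ) [NeZero L] (hL : 1 ≤ L) {𝔸 : Type*} [NormedRing 𝔸] [NormedAlgebra ℂ 𝔸] [CompleteSpace 𝔸] [NormOneClass 𝔸]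
  {W : Type*} [NormedAddCommGroup W] [InnerProductSpace ℂ W] [FiniteDimensional ℂ W] (φ : W ≃ₗ[ℂ] 𝔸)
  {Mφ Mφ' : ℝ} (hMφ : 0 ≤ Mφ) (hMφ' : 0 ≤ Mφ') (hφ : ∀ w, ‖φ w‖ ≤ Mφ * ‖w‖) (hφ' : ∀ X, ‖φ.symm X‖ ≤ Mφ' * ‖X‖)
  {a : ℝ} (ha : 0 < a) {r : ℝ} (hr0 : 0 ≤ r) (hr1 : r < 1)

include hMφ hMφ' hφ hφ' ha hr0 hr1

/-- **[B9] THM 3.11's SECOND HALF AT `k = n+1` LEVELS ON PRINT's DIAGONAL, STRONG, WITH NO DISPLAYED OPERATOR LETTER.**  For the block size `L`, the fibre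
letters `M_φ, M_φ′`, `a > 0` and a profile ratio `0 ≤ r < 1` THERE ARE `α₀, γ′ > 0` (closed forms in `(d, a, L, M_φ, M_φ′, r)`) such that for EVERY number of
levels `n`, spacing `η` with `ηL^{n+1} = 1`, weights `c₀(L^{n+1})^d = c₁`, volume `m`, background `U` of E162's per-level data with mutually adjoint
transporters, `U(b) ∈ U1`, `‖U(b) − 1‖ ≤ αη`, level averages `‖Ū^j(b) − 1‖ ≤ ε_j ≤ αr^j`, and `0 ≤ α ≤ α₀`:
`γ′·(‖D(1)x‖² + ‖D*(1)x‖² + ‖x‖²) ≤ re⟨x, Δ^{(n+1)}_a(U)x⟩` — the owner's `strong_coercive_tower_diagonal` with `hR` := NE9 leaf-04's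
`norm_RofUk_sub_RofUk_one_le_diagonal_linear` at the auxiliary site penalty `a′ = 1` and slopes at `α₀`.
[cite: Balaban1985BackgroundPropagators, Thm 3.11 p.416, (3.16) p.393, (3.25) p.394, (3.35) p.396, p.403, (3.82)–(3.86) p.407; Balaban1984PropagatorsI, Prop. 1.1 (1.90) p.33] -/
theorem exists_strong_coercive_tower_diagonal_closed :
    ∃ α₀ γ' : ℝ, 0 < α₀ ∧ 0 < γ' ∧ ∀ (n : ℕ) (η : ℝ), η * (L : ℝ) ^ (n + 1) = 1 →
      ∀ (c₀ c₁ : ℝ) [Fact (0 < c₀)] [Fact (0 < c₁)], c₀ * ((L : ℝ) ^ (n + 1)) ^ d = c₁ →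
      ∀ (m : Fin d → ℕ) [∀ i, NeZero (m i)] (U : Bond d (towerP L m (n + 1)) → 𝔸ˣ) (αU : ℕ → ℝ) (hα1 : ∀ j, αU j ≤ 1 / 64)
        (hU1 : ∀ (j : ℕ) (x : B7Prop1Explicit.Site d) (κ : Fin d), perCfg (towerP L m (j + 1)) (UlevOf L m (n + 1) U j) x κ ∈ U1 𝔸)
        (hreg : ∀ (j : ℕ) (y : TSite d (towerP L m j)) (κ : Fin d) (r : Fin d → Fin L),
          ‖((Wcx L (perCfg (towerP L m (j + 1)) (UlevOf L m (n + 1) U j)) (cornerSite L y) κ (boxVec L r) : 𝔸ˣ) : 𝔸) - 1‖ ≤ αU j)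
        (εU : ℕ → ℝ), (∀ j, 0 ≤ εU j) → (∀ (j : ℕ) (b : Bond d (towerP L m (j + 1))), ‖(UlevOf L m (n + 1) U j b : 𝔸) - 1‖ ≤ εU j) →
      ∀ {α : ℝ}, 0 ≤ α → α ≤ α₀ →
        (∀ (b : Bond d (towerP L m (n + 1))) (v u : W), ⟪adTransportW φ U b v, u⟫_ℂ = ⟪v, adTransportW φ (fun b => (U b)⁻¹) b u⟫_ℂ) →
        (∀ b, U b ∈ U1 𝔸) → (∀ b, ‖(U b : 𝔸) - 1‖ ≤ α * η) → (∀ j < n + 1, εU j ≤ α * r ^ j) →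
        ∀ x : BondL2K ℂ d (towerP L m (n + 1)) c₀ W,
          γ' * (‖covCurlL2K ℂ c₀ ((η : ℂ))⁻¹ (adTransportW φ (fun _ : Bond d (towerP L m (n + 1)) => (1 : 𝔸ˣ))) x‖ ^ 2 +
              ‖covDivL2K ℂ c₀ ((η : ℂ))⁻¹ (adTransportW φ fun _ : Bond d (towerP L m (n + 1)) => (1 : 𝔸ˣ)⁻¹) x‖ ^ 2 + ‖x‖ ^ 2) ≤
            RCLike.re ⟪x, laplaceALatticeK ((η : ℂ))⁻¹ (adTransportW φ U) (adTransportW φ fun b => (U b)⁻¹) (principalOpK φ η U)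
              (RofUk L m n φ η U) (QkW L m n φ U hL αU hα1 hU1 hreg (c₁ := c₁)) a x⟫_ℂ := by
  have hC : (1 : ℝ) ≤ B5Prop11Plancherel.Cst d a := B5Prop11Lower.one_le_Cst _
  have hL0 : (0 : ℝ) < L := by exact_mod_cast Nat.pos_of_ne_zero (NeZero.ne L)
  have h1r : 0 < 1 - r := by linarith
  have hd0 : (0 : ℝ) ≤ Real.sqrt d := Real.sqrt_nonneg _
  -- the closed letters (K = 2M_φM_φ′; the (3.25) representation at the auxiliary site penalty a′ = 1)
  obtain ⟨K, hKdef⟩ : ∃ K : ℝ, K = 2 * Mφ * Mφ' := ⟨_, rfl⟩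
  have hK : 0 ≤ K := by rw [hKdef]; positivity
  obtain ⟨sD, hsDdef⟩ : ∃ sD : ℝ, sD = Real.sqrt d * (2 * Mφ * Mφ') := ⟨_, rfl⟩
  have hsD : 0 ≤ sD := by rw [hsDdef]; positivity
  obtain ⟨cc, hccdef⟩ : ∃ cc : ℝ, cc = ((d * (L - 1) : ℕ) : ℝ) * (2 * Mφ * Mφ') / (1 - r) := ⟨_, rfl⟩
  have hcc : 0 ≤ cc := by rw [hccdef]; positivity
  obtain ⟨sQ, hsQdef⟩ : ∃ sQ : ℝ, sQ = 2 * (((d * (L - 1) : ℕ) : ℝ) * (2 * Mφ * Mφ') / (1 - r)) := ⟨_, rfl⟩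
  have hsQ : 0 ≤ sQ := by rw [hsQdef]; positivity
  obtain ⟨sS, hsSdef⟩ : ∃ sS : ℝ, sS = Real.sqrt (1 / (12 * (d : ℝ) * (6 / 5) ^ (d - 1) + 1) ^ 2) := ⟨_, rfl⟩
  have hsS : 0 < sS := by rw [hsSdef]; positivity
  obtain ⟨Sbar, hSbardef⟩ : ∃ Sbar : ℝ, Sbar = 2 * (48 * sD + 192 * sQ) + 4 * sQ := ⟨_, rfl⟩
  have hSbar : 0 ≤ Sbar := by rw [hSbardef]; positivity
  obtain ⟨CRb, hCRbdef⟩ : ∃ CRb : ℝ, CRb = 3 * Sbar / sS := ⟨_, rfl⟩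
  have hCRb : 0 ≤ CRb := by rw [hCRbdef]; positivity
  obtain ⟨Ξ, hΞdef⟩ : ∃ Ξ : ℝ, Ξ = Real.sqrt ((L : ℝ) ^ d) * (Real.sqrt (2 * d) * (102 * (d + 1) ^ 2 * L)) := ⟨_, rfl⟩
  have hΞ0 : 0 ≤ Ξ := by rw [hΞdef]; positivity
  obtain ⟨Θb, hΘbdef⟩ : ∃ Θb : ℝ, Θb = 5 * Real.sqrt d * (2 * Mφ * Mφ') + 17 * d * (2 * Mφ * Mφ') ^ 2 + Real.sqrt d * (2 * Mφ * Mφ') * CRb +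
      2 * CRb + CRb ^ 2 + a * (2 * (Mφ' * Mφ) * Ξ / (1 - r)) * (2 * (Mφ' * Mφ) + 2 * (Mφ' * Mφ) * Ξ / (1 - r)) := ⟨_, rfl⟩
  have hΘb : 0 ≤ Θb := by rw [hΘbdef]; positivity
  obtain ⟨γ, hγdef⟩ : ∃ γ : ℝ, γ = 1 / ((d + 1 : ℝ) * B5Prop11Plancherel.Cst d a) := ⟨_, rfl⟩
  have hγ0 : 0 < γ := by rw [hγdef]; positivity
  -- the six thresholds
  obtain ⟨α₁, hα₁def⟩ : ∃ α₁ : ℝ, α₁ = min (1 / (cc + sQ + sD + 1)) (1 / (16 * sD + 24 * sQ + 1)) := ⟨_, rfl⟩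
  have hα₁0 : 0 < α₁ := by rw [hα₁def]; exact lt_min (by positivity) (by positivity)
  refine ⟨min α₁ (min (sS / (2 * Sbar + 1)) (min 1 (min ((1 - r) / (Ξ + 1)) (γ / (2 * Θb + 1))))), γ / 2,
    lt_min hα₁0 (lt_min (by positivity) (lt_min one_pos (lt_min (by positivity) (by positivity)))), by positivity, ?_⟩
  intro n η hηL c₀ c₁ _ _ hw m _ U αU hα1 hU1 hreg εU hεU hUε α hα0 hαle hRS hUb hUη hεg x
  -- name the final threshold (opaque)
  obtain ⟨α₀, hα₀def⟩ : ∃ α₀ : ℝ, α₀ = min α₁ (min (sS / (2 * Sbar + 1)) (min 1 (min ((1 - r) / (Ξ + 1)) (γ / (2 * Θb + 1))))) := ⟨_, rfl⟩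
  rw [← hα₀def] at hαle
  have hα₀0 : 0 < α₀ := by rw [hα₀def]; exact lt_min hα₁0 (lt_min (by positivity) (lt_min one_pos (lt_min (by positivity) (by positivity))))
  have hα₀1 : α₀ ≤ α₁ := by rw [hα₀def]; exact min_le_left _ _
  have hα₀S : α₀ ≤ sS / (2 * Sbar + 1) := by rw [hα₀def]; exact (min_le_right _ _).trans (min_le_left _ _)
  have hα₀one : α₀ ≤ 1 := by rw [hα₀def]; exact (min_le_right _ _).trans ((min_le_right _ _).trans (min_le_left _ _))
  have hα₀Ξ : α₀ ≤ (1 - r) / (Ξ + 1) := by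
    rw [hα₀def]; exact (min_le_right _ _).trans ((min_le_right _ _).trans ((min_le_right _ _).trans (min_le_left _ _)))
  have hα₀Θ : α₀ ≤ γ / (2 * Θb + 1) := by
    rw [hα₀def]; exact (min_le_right _ _).trans ((min_le_right _ _).trans ((min_le_right _ _).trans (min_le_right _ _)))
  have hα₁a : α₁ ≤ 1 / (cc + sQ + sD + 1) := by rw [hα₁def]; exact min_le_left _ _
  have hα₁b : α₁ ≤ 1 / (16 * sD + 24 * sQ + 1) := by rw [hα₁def]; exact min_le_right _ _
  -- stage 1: the windows at α₀ (monotone in α₀ ≤ α₁)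
  have pQ : 0 ≤ sQ * α₀ := mul_nonneg hsQ hα₀0.le
  have pD : 0 ≤ sD * α₀ := mul_nonneg hsD hα₀0.le
  have pc : 0 ≤ cc * α₀ := mul_nonneg hcc hα₀0.le
  have hA : α₀ * (cc + sQ + sD + 1) ≤ 1 := by
    have h := mul_le_mul_of_nonneg_right (hα₀1.trans hα₁a) (by positivity : 0 ≤ cc + sQ + sD + 1)
    rwa [one_div, inv_mul_cancel₀ (by positivity : cc + sQ + sD + 1 ≠ 0)] at h
  have eA : α₀ * (cc + sQ + sD + 1) = cc * α₀ + sQ * α₀ + sD * α₀ + α₀ := by ring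
  rw [eA] at hA
  have hc1 : cc * α₀ ≤ 1 := by linarith
  have hθb1 : sQ * α₀ ≤ 1 := by linarith
  have hsD1 : sD * α₀ ≤ 1 := by linarith
  have hB : α₀ * (16 * sD + 24 * sQ + 1) ≤ 1 := by
    have h := mul_le_mul_of_nonneg_right (hα₀1.trans hα₁b) (by positivity : 0 ≤ 16 * sD + 24 * sQ + 1)
    rwa [one_div, inv_mul_cancel₀ (by positivity : 16 * sD + 24 * sQ + 1 ≠ 0)] at h
  have eB : α₀ * (16 * sD + 24 * sQ + 1) = 16 * (sD * α₀) + 24 * (sQ * α₀) + α₀ := by ring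
  rw [eB] at hB
  have h3 : 2 * (sD * α₀) + 3 * (sQ * α₀) ≤ 1 / 8 := by linarith
  -- the letters at α₀ (a′ = 1), opaque names with definitional equalities
  obtain ⟨θb, hθbdef⟩ : ∃ θb : ℝ, θb = sQ * α₀ := ⟨_, rfl⟩
  obtain ⟨γm, hγmdef⟩ : ∃ γm : ℝ, γm = 1 / (2 + 2 / (1 : ℝ)) - (sD * α₀ + (sD * α₀) ^ 2 + (1 : ℝ) * θb * (2 * 1 + θb)) := ⟨_, rfl⟩
  obtain ⟨sG, hsGdef⟩ : ∃ sG : ℝ, sG = 2 * sD * (γm⁻¹ * (Real.sqrt γm)⁻¹) + (|(1 : ℝ)| * sQ * ((1 + θb) + 1)) * γm⁻¹ ^ 2 := ⟨_, rfl⟩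
  obtain ⟨sA, hsAdef⟩ : ∃ sA : ℝ, sA = sG * (1 + θb) + (2 + 2 / (1 : ℝ)) * sQ := ⟨_, rfl⟩
  have hθb0 : 0 ≤ θb := by rw [hθbdef]; exact pQ
  have hθble : θb ≤ 1 := by rw [hθbdef]; exact hθb1
  have hγm : 1 / 8 ≤ γm := gamma_m_ge hsD hsQ hα₀0.le h3 hθbdef hγmdef
  have hγm0 : 0 < γm := lt_of_lt_of_le (by norm_num) hγm
  -- stage 2: s_A ≤ S̄, hence leaf-04's window
  have hsAle : sA ≤ Sbar := by rw [hSbardef]; exact sA_le_bar hsD hsQ hθb0 hθble hγm hsGdef hsAdef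
  have hsG0 : 0 ≤ sG := by rw [hsGdef]; positivity
  have hsA0 : 0 ≤ sA := by rw [hsAdef]; positivity
  have hwin : 2 * sA * α₀ ≤ sS := by
    have h1 : 2 * sA * α₀ ≤ 2 * Sbar * (sS / (2 * Sbar + 1)) :=
      mul_le_mul (mul_le_mul_of_nonneg_left hsAle (by norm_num)) hα₀S hα₀0.le (by positivity)
    have h2 : 2 * Sbar * (sS / (2 * Sbar + 1)) ≤ sS := by
      rw [mul_div_assoc', div_le_iff₀ (by positivity)]
      have e : sS * (2 * Sbar + 1) = 2 * Sbar * sS + sS := by ring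
      rw [e]; linarith [hsS.le]
    exact h1.trans h2
  -- the R-letter from leaf-04 (a′ = 1, slopes at α₀)
  have hLb := hLb_of_hU1 L m n U hU1
  have hR : ∀ y : SiteL2K ℂ d (towerP L m (n + 1)) c₀ W,
      ‖RofUk L m n φ η U y - RofUk L m n φ η (fun _ : Bond d (towerP L m (n + 1)) => (1 : 𝔸ˣ)) y‖ ≤ (3 * sA / sS) * α * ‖y‖ :=
    fun y => norm_RofUk_sub_RofUk_one_le_diagonal_linear L m n φ hMφ hMφ' hφ hφ' c₀ η c₁ (one_pos : (0 : ℝ) < 1) hηL hw U hRS hα0 hUb hUη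
      εU hεU hUε hLb hr0 hr1 hαle hεg hsDdef hsQdef hθbdef hγmdef hsGdef hsAdef hsSdef (by rw [← hccdef]; exact hc1) hγm0 hwin y
  -- the R-letter's constant is below CRb, so the diagonal thresholds at CRb imply those at 3sA/sS
  have hCRle : 3 * sA / sS ≤ CRb := by
    rw [hCRbdef]; exact div_le_div_of_nonneg_right (by linarith) hsS.le
  have hCR0 : 0 ≤ 3 * sA / sS := by positivity
  have hΘle := theta_mono (d := d) (a := a) (KR := 2 * Mφ * Mφ') (CQ := 2 * (Mφ' * Mφ) * Ξ / (1 - r)) (MQ := Mφ' * Mφ)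
    (by positivity) hCR0 hCRle
  rw [← hΘbdef] at hΘle
  have hΘ0 : 0 ≤ 5 * Real.sqrt d * (2 * Mφ * Mφ') + 17 * d * (2 * Mφ * Mφ') ^ 2 + Real.sqrt d * (2 * Mφ * Mφ') * (3 * sA / sS) +
      2 * (3 * sA / sS) + (3 * sA / sS) ^ 2 + a * (2 * (Mφ' * Mφ) * Ξ / (1 - r)) * (2 * (Mφ' * Mφ) + 2 * (Mφ' * Mφ) * Ξ / (1 - r)) := by
    positivity
  have hden := add_le_add (mul_le_mul_of_nonneg_left hΘle (by norm_num : (0 : ℝ) ≤ 2)) (le_refl (1 : ℝ))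
  have hpos := add_pos_of_nonneg_of_pos (mul_nonneg (by norm_num : (0 : ℝ) ≤ 2) hΘ0) (one_pos : (0 : ℝ) < 1)
  have hαΘ := (hαle.trans hα₀Θ).trans (div_le_div_of_nonneg_left hγ0.le hpos hden)
  have hαΞ : Ξ * α ≤ 1 - r := by
    have h1 : Ξ * α ≤ Ξ * ((1 - r) / (Ξ + 1)) := mul_le_mul_of_nonneg_left (hαle.trans hα₀Ξ) hΞ0
    have h2 : Ξ * ((1 - r) / (Ξ + 1)) ≤ 1 - r := by
      rw [mul_div_assoc', div_le_iff₀ (by positivity)]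
      have e : (1 - r) * (Ξ + 1) = Ξ * (1 - r) + (1 - r) := by ring
      rw [e]; linarith
    exact h1.trans h2
  have key := strong_coercive_tower_diagonal L m n hL φ hMφ hMφ' hφ hφ' ha U αU hα1 hU1 hreg εU hεU hUε hRS hCR0 hα0 hr0 hr1 hUb hUη hεg hR hηL hw
    (hαle.trans hα₀one) (by rw [← hΞdef]; exact hαΞ) (by rw [← hΞdef, ← hγdef]; exact hαΘ) x
  rw [← hγdef] at key
  exact key

end Exists

end Literature.MathematicalPhysics.QuantumFieldTheory.Balaban1983to89.B9Thm311SmallFieldCoercivityTowerClosed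

end
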